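import Mathlib.Analysis.InnerProductSpace.PiL2
import Mathlib.Algebra.Order.Floor.Defs
import Mathlib.Algebra.BigOperators.Ring.Finset
import HarnessLib

/-!
# A lateral grid offset that few points are close to (finite double counting)

HONEST FRAMING. Part of the venture `Summits/Ventures/Crystal3D` (cell `crystal3d-full`), helper for the
crux `TextureLiminf` (stmt-Ventures-19483) of `route-Ventures-StickyWulffConstant`, line `TexShadow`, item n1
of the coordinator (shape-independent sub-lemmas of `textureBuild`): the texture is read off a packing on the
cells of a square lateral grid of side `ρ`, and the grid must be OFFSET so that only `O(#F/ρ)` of the `#F`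
balls lie within distance `1` of a grid plane (§73.9(ii) of the blueprint: "random offset").  This file is
the measure-free version: among the `m` candidate offsets `0, 2, …, 2(m-1)` (`2m ≤ ρ`) of one family of
grid lines, every point is close to at most ONE candidate, so some candidate has at most `#F/m` close points;
two families give `2 #F/m ≤ 4 #F/(ρ - 2)`.

**Theorem** (`exists_gridOffset_card_near_le`).  `F` finite with two real coordinates `f₀, f₁`, `ρ` real,
`m ≥ 1` an integer with `2m ≤ ρ`: there are offsets `v₀, v₁ ∈ [0, ρ)` such that the number of `x ∈ F` with
`f₀ x` within distance `< 1` of `v₀ + ρℤ` or `f₁ x` within distance `< 1` of `v₁ + ρℤ` is `≤ 2 #F / m`;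
`exists_gridOffset_card_near_le_of_four_le`: for `ρ ≥ 4`, `≤ 4 #F / (ρ - 2)`.

WHAT THIS IS NOT: nothing about packings; the scale choice and the cell census of `textureBuild` are
elsewhere.
-/

noncomputable section

open scoped Classical

namespace Summit.Ventures.Crystal3D.Theorems

open Finset

/-- Two candidate offsets `2k, 2k'` (`k, k' < m`, `2m ≤ ρ`) both within distance `< 1` of `a` modulo `ρℤ`
coincide. -/
theorem nearGrid_candidate_unique (ρ a : ℝ) (m : ℕ) (hm : 2 * (m : ℝ) ≤ ρ) (k k' : ℕ) (hk : k < m)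
    (hk' : k' < m) (h : ∃ n : ℤ, |a - 2 * (k : ℝ) - n * ρ| < 1)
    (h' : ∃ n : ℤ, |a - 2 * (k' : ℝ) - n * ρ| < 1) : k = k' := by
  obtain ⟨n, hn⟩ := h
  obtain ⟨n', hn'⟩ := h'
  have hkm : (k : ℝ) + 1 ≤ m := by exact_mod_cast hk
  have hk'm : (k' : ℝ) + 1 ≤ m := by exact_mod_cast hk'
  have hk0 : (0 : ℝ) ≤ k := Nat.cast_nonneg k
  have hk'0 : (0 : ℝ) ≤ k' := Nat.cast_nonneg k'
  have hn1 := (abs_lt.1 hn).1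
  have hn2 := (abs_lt.1 hn).2
  have hn'1 := (abs_lt.1 hn').1
  have hn'2 := (abs_lt.1 hn').2
  have hρ0 : 0 ≤ ρ := by linarith
  rcases lt_trichotomy n n' with hlt | heq | hgt
  · exfalso
    have h1 : (n : ℝ) + 1 ≤ n' := by exact_mod_cast hlt
    have : ((n' : ℝ) - n) * ρ ≥ ρ := by nlinarith
    nlinarith
  · subst heq
    by_contra hne
    rcases Nat.lt_or_gt_of_ne hne with hlt | hgt
    · have : (k : ℝ) + 1 ≤ k' := by exact_mod_cast hlt
      linarith
    · have : (k' : ℝ) + 1 ≤ k := by exact_mod_cast hgt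
      linarith
  · exfalso
    have h1 : (n' : ℝ) + 1 ≤ n := by exact_mod_cast hgt
    have : ((n : ℝ) - n') * ρ ≥ ρ := by nlinarith
    nlinarith

/-- Double counting: over the `m` candidate offsets `2k` (`k < m`, `2m ≤ ρ`) of one family of grid lines,
the close points add up to at most `#F`. -/
theorem sum_card_nearGrid_le {ι : Type*} (F : Finset ι) (f : ι → ℝ) (ρ : ℝ) (m : ℕ)
    (hm : 2 * (m : ℝ) ≤ ρ) :
    ∑ k ∈ range m, (F.filter fun x => ∃ n : ℤ, |f x - 2 * (k : ℝ) - n * ρ| < 1).card ≤ F.card := by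
  rw [← card_biUnion]
  · exact card_le_card (biUnion_subset.2 fun k _ => filter_subset _ _)
  · intro k hk k' hk' hne
    rw [Function.onFun, disjoint_left]
    intro x hx hx'
    exact hne (nearGrid_candidate_unique ρ (f x) m hm k k' (mem_range.1 hk) (mem_range.1 hk')
      (mem_filter.1 hx).2 (mem_filter.1 hx').2)

/-- Pigeonhole: some candidate offset `2k`, `k < m`, has at most `#F / m` close points. -/
theorem exists_offset_card_nearGrid_le {ι : Type*} (F : Finset ι) (f : ι → ℝ) (ρ : ℝ) (m : ℕ)
    (hm1 : 1 ≤ m) (hm : 2 * (m : ℝ) ≤ ρ) :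
    ∃ k < m, (((F.filter fun x => ∃ n : ℤ, |f x - 2 * (k : ℝ) - n * ρ| < 1).card : ℝ)) ≤
      F.card / m := by
  have hne : (range m).Nonempty := ⟨0, mem_range.2 hm1⟩
  have hsum : ∑ k ∈ range m,
      (((F.filter fun x => ∃ n : ℤ, |f x - 2 * (k : ℝ) - n * ρ| < 1).card : ℝ)) ≤
      ∑ _k ∈ range m, ((F.card : ℝ) / m) := by
    have hm0 : (m : ℝ) ≠ 0 := by
      have : (1 : ℝ) ≤ m := by exact_mod_cast hm1
      linarith
    rw [sum_const, card_range, nsmul_eq_mul, mul_div_cancel₀ _ hm0]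
    exact_mod_cast sum_card_nearGrid_le F f ρ m hm
  obtain ⟨k, hk, hle⟩ := exists_le_of_sum_le hne hsum
  exact ⟨k, mem_range.1 hk, hle⟩

/-- **A good lateral grid offset.**  `F` finite with coordinates `f₀, f₁ : ι → ℝ`, `m ≥ 1` with `2m ≤ ρ`:
there are `v₀, v₁ ∈ [0, ρ)` such that at most `2 #F / m` members of `F` have `f₀` within distance `< 1` of
`v₀ + ρℤ` or `f₁` within distance `< 1` of `v₁ + ρℤ`. -/
theorem exists_gridOffset_card_near_le {ι : Type*} (F : Finset ι) (f₀ f₁ : ι → ℝ) (ρ : ℝ) (m : ℕ)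
    (hm1 : 1 ≤ m) (hm : 2 * (m : ℝ) ≤ ρ) :
    ∃ v₀ v₁ : ℝ, 0 ≤ v₀ ∧ v₀ < ρ ∧ 0 ≤ v₁ ∧ v₁ < ρ ∧
      (((F.filter fun x => (∃ n : ℤ, |f₀ x - v₀ - n * ρ| < 1) ∨
        (∃ n : ℤ, |f₁ x - v₁ - n * ρ| < 1)).card : ℝ)) ≤ 2 * F.card / m := by
  obtain ⟨k₀, hk₀, h₀⟩ := exists_offset_card_nearGrid_le F f₀ ρ m hm1 hm
  obtain ⟨k₁, hk₁, h₁⟩ := exists_offset_card_nearGrid_le F f₁ ρ m hm1 hm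
  have hk₀m : (k₀ : ℝ) + 1 ≤ m := by exact_mod_cast hk₀
  have hk₁m : (k₁ : ℝ) + 1 ≤ m := by exact_mod_cast hk₁
  refine ⟨2 * (k₀ : ℝ), 2 * (k₁ : ℝ), by positivity, by linarith, by positivity, by linarith, ?_⟩
  rw [filter_or]
  have hu := card_union_le (F.filter fun x => ∃ n : ℤ, |f₀ x - 2 * (k₀ : ℝ) - n * ρ| < 1)
    (F.filter fun x => ∃ n : ℤ, |f₁ x - 2 * (k₁ : ℝ) - n * ρ| < 1)
  have hu' : (((F.filter fun x => ∃ n : ℤ, |f₀ x - 2 * (k₀ : ℝ) - n * ρ| < 1) ∪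
      (F.filter fun x => ∃ n : ℤ, |f₁ x - 2 * (k₁ : ℝ) - n * ρ| < 1)).card : ℝ) ≤
      ((F.filter fun x => ∃ n : ℤ, |f₀ x - 2 * (k₀ : ℝ) - n * ρ| < 1).card : ℝ) +
        ((F.filter fun x => ∃ n : ℤ, |f₁ x - 2 * (k₁ : ℝ) - n * ρ| < 1).card : ℝ) := by
    exact_mod_cast hu
  have : (F.card : ℝ) / m + F.card / m = 2 * F.card / m := by ring
  linarith

/-- The same with the explicit choice `m = ⌊ρ/2⌋` for `ρ ≥ 4`: at most `4 #F / (ρ - 2)` close points. -/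
theorem exists_gridOffset_card_near_le_of_four_le {ι : Type*} (F : Finset ι) (f₀ f₁ : ι → ℝ) (ρ : ℝ)
    (hρ : 4 ≤ ρ) :
    ∃ v₀ v₁ : ℝ, 0 ≤ v₀ ∧ v₀ < ρ ∧ 0 ≤ v₁ ∧ v₁ < ρ ∧
      (((F.filter fun x => (∃ n : ℤ, |f₀ x - v₀ - n * ρ| < 1) ∨
        (∃ n : ℤ, |f₁ x - v₁ - n * ρ| < 1)).card : ℝ)) ≤ 4 * F.card / (ρ - 2) := by
  set m : ℕ := ⌊ρ / 2⌋₊ with hmdef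
  have hρ2 : 0 ≤ ρ / 2 := by linarith
  have hmle : (m : ℝ) ≤ ρ / 2 := Nat.floor_le hρ2
  have hmlt : ρ / 2 < (m : ℝ) + 1 := Nat.lt_floor_add_one _
  have hm1 : 1 ≤ m := by
    rw [hmdef]; exact Nat.le_floor (by norm_num; linarith)
  have hm : 2 * (m : ℝ) ≤ ρ := by linarith
  obtain ⟨v₀, v₁, h1, h2, h3, h4, hle⟩ := exists_gridOffset_card_near_le F f₀ f₁ ρ m hm1 hm
  refine ⟨v₀, v₁, h1, h2, h3, h4, hle.trans ?_⟩
  have hmpos : (0 : ℝ) < m := by exact_mod_cast hm1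
  have hρm : ρ - 2 < 2 * (m : ℝ) := by linarith
  rw [div_le_div_iff₀ hmpos (by linarith)]
  have hF : (0 : ℝ) ≤ F.card := Nat.cast_nonneg _
  nlinarith

end Summit.Ventures.Crystal3D.Theorems

end
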